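import Mathlib
import Literature.Analysis.FluidPDE.LoopCirculation
import Summits.NavierStokesRegularity.NavierStokesRegularity.Theorems.TautLoopKelvinTautLoopLawLevelLeftContinuityTools2
import Summits.NavierStokesRegularity.NavierStokesRegularity.Theorems.TautLoopKelvinTautLoopLawLevelLeftContinuityTools3
import HarnessLib

/-!
# Route `TautLoopKelvin`, crux `TautLoopLaw` (stmt-NavierStokesRegularity-15249), line
  `Sketch-ideas-r1k1` (Dini–Saks architecture) — stub `stub_tautLoopLevelLeftContinuity`

Write `ℓ(v, g) := inf {len γ : γ a closed C¹ loop, g ≤ |∮_γ v · dℓ|} ∈ [0, ∞]` (`inf ∅ = ⊤`,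
`len γ = ∫₀¹ ‖γ′‖`, `∮_γ v · dℓ = Literature.Analysis.FluidPDE.circulation v γ`) for the
circulation–length spectrum of a field `v : ℝ³ → ℝ³`.

**Statement.** For a `C²` field `v` tending to `0` at infinity and a level `g > 0` (with nonempty
admissible class), `ℓ(v, g) ≤ sup_{0 < g' < g} ℓ(v, g')`: the spectrum has no jump from the left.

**Proof.** Suppose `L := sup_{g' < g} ℓ(v, g') < ℓ(v, g)`; pick `r > 0` with `L + r < ℓ(v, g)`, so
that every loop admissible at level `g` is longer than `L + r` (∗). For each `n` pick a loop `γₙ`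
admissible at level `g - g/(n+2)` with `len γₙ < L + r/2`; by (∗), `|∮_{γₙ} v| < g`.
*Confinement:* since `v → 0` at infinity and `|∮| ≤ sup_loop ‖v‖ · len`, all `γₙ` lie in a fixed
ball. *Dichotomy:* either (B1) for every `d > 0` some vorticity `‖curl v‖ ≥ w(d) > 0` is found
within distance `d` of infinitely many `γₙ` — then a lasso through a small circle around such a
point (tools part 2, `tautLoopLlc_lasso_gain`, with `d` and the length budget `∼ r`) repays the
deficit `g/(n+2)` for `n` large and produces a loop admissible at level `g` of length `< L + r`,
contradicting (∗); or (B2) for some `d₀ > 0` the vorticity dies out uniformly on the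
`d₀`-neighbourhood of `γₙ` — then the circulations `∮_{γₙ} v` eventually lie in a finite set (tools
part 3, `tautLoopLlc_quantised`: local potentials near the vorticity-free limit set), which is
incompatible with `g - g/(n+2) ≤ |∮_{γₙ} v| < g`.
-/

noncomputable section

open Set MeasureTheory Filter Topology Function Real intervalIntegral Metric
  Literature.Analysis.FluidPDE
open scoped ENNReal NNReal InnerProductSpace RealInnerProductSpace

namespace Summit.NavierStokesRegularity.NavierStokesRegularity.Theorems

set_option linter.dupNamespace false

local notation3 "E3" => EuclideanSpace ℝ (Fin 3)

/-! ## Confinement of loops carrying circulation -/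

/-- `|∮_γ v · dℓ| ≤ κ · len γ` when `‖v‖ ≤ κ` along the closed `C¹` loop `γ`. [folklore] -/
theorem tautLoopLlc_abs_circulation_le {v : E3 → E3} (hv : Continuous v) {κ : ℝ}
    {γ : ℝ → E3} (hγ : IsC1Loop γ) (hκ : ∀ s, ‖v (γ s)‖ ≤ κ) :
    |circulation v γ| ≤ κ * ∫ σ in (0:ℝ)..1, ‖deriv γ σ‖ := by
  unfold circulation
  rw [← intervalIntegral.integral_const_mul]
  refine (intervalIntegral.abs_integral_le_integral_abs zero_le_one).trans ?_
  refine intervalIntegral.integral_mono_on zero_le_one ?_ ?_ (fun σ _ => ?_)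
  · exact ((hv.comp hγ.continuous).inner hγ.continuous_deriv).abs.intervalIntegrable 0 1
  · exact (continuous_const.mul hγ.continuous_deriv.norm).intervalIntegrable 0 1
  · exact (abs_real_inner_le_norm _ _).trans (mul_le_mul_of_nonneg_right (hκ _) (norm_nonneg _))

/-- Every point of a closed `C¹` loop is within `len γ` of its base point `γ 0`. [folklore] -/
theorem tautLoopLlc_norm_sub_base_le {γ : ℝ → E3} (hγ : IsC1Loop γ) (s : ℝ) :
    ‖γ s - γ 0‖ ≤ ∫ σ in (0:ℝ)..1, ‖deriv γ σ‖ := by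
  obtain ⟨u, hu, hus⟩ := hγ.periodic.exists_mem_Ico₀ zero_lt_one s
  rw [hus]
  have hc : Continuous fun σ => ‖deriv γ σ‖ := hγ.continuous_deriv.norm
  have hFTC : ∫ σ in (0:ℝ)..u, deriv γ σ = γ u - γ 0 :=
    integral_deriv_eq_sub (fun x _ => hγ.differentiable x)
      (hγ.continuous_deriv.intervalIntegrable _ _)
  calc ‖γ u - γ 0‖ = ‖∫ σ in (0:ℝ)..u, deriv γ σ‖ := by rw [hFTC]
    _ ≤ |∫ σ in (0:ℝ)..u, ‖deriv γ σ‖| := norm_integral_le_abs_integral_norm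
    _ = ∫ σ in (0:ℝ)..u, ‖deriv γ σ‖ :=
        abs_of_nonneg (intervalIntegral.integral_nonneg hu.1 fun σ _ => norm_nonneg _)
    _ ≤ ∫ σ in (0:ℝ)..1, ‖deriv γ σ‖ :=
        intervalIntegral.integral_mono_interval le_rfl hu.1 hu.2.le
          (Eventually.of_forall fun σ => norm_nonneg _) (hc.intervalIntegrable 0 1)

/-- **Confinement.** If the continuous field `v` tends to `0` at infinity, then for `κ > 0` and
`ℓ` there is a radius `R₀` such that every closed `C¹` loop of length `≤ ℓ` with `|∮ v| > κ ℓ` lies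
in the ball of radius `R₀`: such a loop must visit the compact region `{‖v‖ ≥ κ}`, and its
diameter is at most its length. [folklore] -/
theorem tautLoopLlc_confinement {v : E3 → E3} (hv : Continuous v)
    (hdec : Tendsto v (cocompact E3) (𝓝 0)) {κ : ℝ} (hκ : 0 < κ) (ℓ : ℝ) :
    ∃ R₀ : ℝ, ∀ γ : ℝ → E3, IsC1Loop γ → (∫ σ in (0:ℝ)..1, ‖deriv γ σ‖) ≤ ℓ →
      κ * ℓ < |circulation v γ| → ∀ s, ‖γ s‖ ≤ R₀ := by
  have hev : ∀ᶠ x in cocompact E3, ‖v x‖ < κ := by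
    simpa [dist_zero_right] using (Metric.tendsto_nhds.1 hdec) κ hκ
  obtain ⟨K, hK, hKv⟩ := Filter.hasBasis_cocompact.eventually_iff.1 hev
  obtain ⟨R₁, hR₁⟩ := hK.isBounded.subset_closedBall 0
  refine ⟨R₁ + ℓ, fun γ hγ hlen hcirc s => ?_⟩
  -- some point of the loop sees `‖v‖ ≥ κ`, hence lies in the ball of radius `R₁`
  obtain ⟨s₀, hs₀⟩ : ∃ s₀, ‖γ s₀‖ ≤ R₁ := by
    by_contra h
    push Not at h
    have hsmall : ∀ s, ‖v (γ s)‖ ≤ κ := fun s => by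
      have hs : γ s ∈ Kᶜ := fun hmem => by
        have := hR₁ hmem
        rw [mem_closedBall, dist_zero_right] at this
        exact (not_lt.2 this) (h s)
      exact (hKv hs).le
    have h1 := tautLoopLlc_abs_circulation_le hv hγ hsmall
    have h2 : κ * (∫ σ in (0:ℝ)..1, ‖deriv γ σ‖) ≤ κ * ℓ := mul_le_mul_of_nonneg_left hlen hκ.le
    linarith
  -- every other point is within `len γ ≤ ℓ` of it
  have hdiam : ‖γ s - γ s₀‖ ≤ ∫ σ in (0:ℝ)..1, ‖deriv γ σ‖ := by
    have h := tautLoopLlc_norm_sub_base_le (hγ.comp_add_const s₀) (s - s₀)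
    simp only [sub_add_cancel, zero_add] at h
    rwa [tautLoopLlc_len_comp_add_const hγ.periodic s₀] at h
  have := norm_le_norm_add_norm_sub' (γ s) (γ s₀)  -- ‖a‖ ≤ ‖b‖ + ‖a - b‖
  linarith

/-! ## The stub -/

local notation3 "ℓ⟦" v ", " g "⟧" => (⨅ (γ' : ℝ → EuclideanSpace ℝ (Fin 3))
  (_ : Literature.Analysis.FluidPDE.IsC1Loop γ' ∧
    g ≤ |Literature.Analysis.FluidPDE.circulation v γ'|),
  ENNReal.ofReal (∫ σ in (0:ℝ)..1, ‖deriv γ' σ‖))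

/-- **Level left-continuity of the circulation–length spectrum of one field.** For a `C²` field
`v` on `ℝ³` tending to `0` at infinity and a level `g > 0` with nonempty admissible class,
`ℓ(v, g) ≤ sup_{0 < g' < g} ℓ(v, g')`: near-optimal loops at levels `g' ↑ g` are confined; either
some vorticity persists near them, and a small lasso repays the level deficit at vanishing cost of
length, or the vorticity dies out near them, and their circulations are eventually quantised (local
potentials), hence already `≥ g`. [folklore] -/
theorem stub_tautLoopLevelLeftContinuity : ∀ (v : EuclideanSpace ℝ (Fin 3) → EuclideanSpace ℝ (Fin 3)), ContDiff ℝ 2 v → Filter.Tendsto v (Filter.cocompact (EuclideanSpace ℝ (Fin 3))) (nhds 0) → ∀ g : ℝ, 0 < g → (∃ γ : ℝ → EuclideanSpace ℝ (Fin 3), Literature.Analysis.FluidPDE.IsC1Loop γ ∧ g ≤ |Literature.Analysis.FluidPDE.circulation v γ|) → (⨅ (γ' : ℝ → EuclideanSpace ℝ (Fin 3)) (_ : Literature.Analysis.FluidPDE.IsC1Loop γ' ∧ g ≤ |Literature.Analysis.FluidPDE.circulation v γ'|), ENNReal.ofReal (∫ σ in (0:ℝ)..1, ‖deriv γ' σ‖))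 ≤ ⨆ (g' : ℝ) (_ : 0 < g' ∧ g' < g), (⨅ (γ' : ℝ → EuclideanSpace ℝ (Fin 3)) (_ : Literature.Analysis.FluidPDE.IsC1Loop γ' ∧ g' ≤ |Literature.Analysis.FluidPDE.circulation v γ'|), ENNReal.ofReal (∫ σ in (0:ℝ)..1, ‖deriv γ' σ‖)) := by
  intro v hv hdec g hg _hne
  have hv1 : ContDiff ℝ 1 v := hv.of_le one_le_two
  have hvc : Continuous v := hv.continuous
  have hlen0 : ∀ γ : ℝ → E3, 0 ≤ ∫ σ in (0:ℝ)..1, ‖deriv γ σ‖ := fun γ =>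
    intervalIntegral.integral_nonneg zero_le_one fun σ _ => norm_nonneg _
  set L := ⨆ (g' : ℝ) (_ : 0 < g' ∧ g' < g), ℓ⟦v, g'⟧ with hL_def
  by_contra hcon
  have hLlt : L < ℓ⟦v, g⟧ := not_le.1 hcon
  have hLtop : L ≠ ⊤ := hLlt.ne_top
  obtain ⟨r, hr, hLr⟩ := ENNReal.lt_iff_exists_add_pos_lt.1 hLlt
  set Lr : ℝ := L.toReal with hLr_def
  have hLr0 : 0 ≤ Lr := ENNReal.toReal_nonneg
  have hrr : (0:ℝ) < r := hr
  -- (∗) every loop admissible at level `g` is longer than `Lr + r`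
  have hlong : ∀ γ : ℝ → E3, IsC1Loop γ → g ≤ |circulation v γ| →
      Lr + r < ∫ σ in (0:ℝ)..1, ‖deriv γ σ‖ := by
    intro γ hγ hgγ
    have h1 : L + r < ENNReal.ofReal (∫ σ in (0:ℝ)..1, ‖deriv γ σ‖) :=
      hLr.trans_le (iInf₂_le γ ⟨hγ, hgγ⟩)
    have h2 : L + (r : ℝ≥0∞) ≠ ⊤ := ENNReal.add_ne_top.2 ⟨hLtop, ENNReal.coe_ne_top⟩
    have h3 := (ENNReal.toReal_lt_toReal h2 ENNReal.ofReal_ne_top).2 h1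
    rwa [ENNReal.toReal_ofReal (hlen0 γ), ENNReal.toReal_add hLtop ENNReal.coe_ne_top,
      ENNReal.coe_toReal] at h3
  -- near-optimal loops at the levels `g - g/(n+2)`
  have hseq : ∀ n : ℕ, ∃ γ : ℝ → E3, IsC1Loop γ ∧ g - g / (n + 2) ≤ |circulation v γ| ∧
      (∫ σ in (0:ℝ)..1, ‖deriv γ σ‖) < Lr + r / 2 := by
    intro n
    have hn2 : (0:ℝ) < n + 2 := by positivity
    have hgn : 0 < g / (n + 2) := by positivity
    have hgn' : g / (n + 2) < g := by
      rw [div_lt_iff₀ hn2]; nlinarith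
    have hlev : 0 < g - g / (n + 2) ∧ g - g / (n + 2) < g := ⟨by linarith, by linarith⟩
    have h1 : ℓ⟦v, g - g / (n + 2)⟧ ≤ L :=
      le_iSup₂ (f := fun (g' : ℝ) (_ : 0 < g' ∧ g' < g) => ℓ⟦v, g'⟧) _ hlev
    have hε : ENNReal.ofReal (r / 2) ≠ 0 := (ENNReal.ofReal_pos.2 (by positivity)).ne'
    have h2 : L < L + ENNReal.ofReal (r / 2) := ENNReal.lt_add_right hLtop hε
    obtain ⟨γ, hγ⟩ := iInf_lt_iff.1 (h1.trans_lt h2)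
    obtain ⟨⟨hγloop, hγg⟩, hγlen⟩ := iInf_lt_iff.1 hγ
    have htop : L + ENNReal.ofReal (r / 2) ≠ ⊤ :=
      ENNReal.add_ne_top.2 ⟨hLtop, ENNReal.ofReal_ne_top⟩
    have h3 := (ENNReal.ofReal_lt_iff_lt_toReal (hlen0 γ) htop).1 hγlen
    rw [ENNReal.toReal_add hLtop ENNReal.ofReal_ne_top,
      ENNReal.toReal_ofReal (by positivity : (0:ℝ) ≤ r / 2)] at h3
    exact ⟨γ, hγloop, hγg, h3⟩
  choose γ hγ hgγ hlenγ using hseq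
  have habs : ∀ n, |circulation v (γ n)| < g := fun n => by
    by_contra h
    have := hlong (γ n) (hγ n) (not_lt.1 h)
    linarith [hlenγ n]
  have hhalf : ∀ n : ℕ, g / 2 ≤ |circulation v (γ n)| := fun n => by
    have h1 : g / ((n:ℝ) + 2) ≤ g / 2 :=
      div_le_div_of_nonneg_left hg.le two_pos (by linarith [(Nat.cast_nonneg n : (0:ℝ) ≤ n)])
    linarith [hgγ n]
  -- confinement
  set ℓ₀ : ℝ := Lr + r / 2 with hℓ₀
  have hℓ₀0 : 0 < ℓ₀ := by positivity
  obtain ⟨R₀, hR₀⟩ := tautLoopLlc_confinement hvc hdec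
    (κ := g / (2 * ℓ₀ + 1)) (by positivity) ℓ₀
  have hR : ∀ n s, ‖γ n s‖ ≤ R₀ := fun n =>
    hR₀ (γ n) (hγ n) (hlenγ n).le (by
      have h1 : g / (2 * ℓ₀ + 1) * ℓ₀ < g / 2 := by
        rw [div_mul_eq_mul_div, div_lt_div_iff₀ (by positivity) two_pos]
        nlinarith
      linarith [hhalf n])
  -- the dichotomy
  by_cases hB : ∀ d : ℝ, 0 < d → ∃ w : ℝ, 0 < w ∧
      ∃ᶠ n in atTop, ∃ (x : E3) (s : ℝ), dist x (γ n s) ≤ d ∧ w ≤ ‖curl v x‖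
  · -- (B1) persistent vorticity near the loops: a lasso repays the deficit
    obtain ⟨w, hw, hfreq⟩ := hB (r / 16) (by positivity)
    obtain ⟨G₀, hG₀, hgain⟩ := tautLoopLlc_lasso_gain hv R₀ (r / 16) w (r / 4) hw (by positivity)
    obtain ⟨N, hN⟩ := exists_nat_gt (g / G₀)
    have hev : ∀ᶠ n : ℕ in atTop, g / (n + 2) ≤ G₀ := by
      refine eventually_atTop.2 ⟨N, fun n hn => ?_⟩
      have hn' : (N:ℝ) ≤ n := by exact_mod_cast hn
      rw [div_lt_iff₀ hG₀] at hN
      rw [div_le_iff₀ (by positivity)]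
      nlinarith
    obtain ⟨n, ⟨x, s, hxs, hwx⟩, hn⟩ := (hfreq.and_eventually hev).exists
    obtain ⟨Λ, hΛ, hΛc, hΛl⟩ := hgain (γ n) (hγ n) (hR n) x s hxs hwx
    have h1 : g ≤ |circulation v Λ| := by linarith [hgγ n]
    have h2 := hlong Λ hΛ h1
    have h3 : π * (r / 16) ≤ r / 4 := by nlinarith [Real.pi_le_four]
    linarith [hlenγ n]
  · -- (B2) the vorticity dies out near the loops: quantised circulations
    obtain ⟨d₀, hd'⟩ := not_forall.1 hB
    obtain ⟨hd₀, hnot⟩ := Classical.not_imp.1 hd'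
    have hflat : ∀ w : ℝ, 0 < w → ∀ᶠ n in atTop, ∀ (x : E3) (s : ℝ),
        dist x (γ n s) ≤ d₀ → ‖curl v x‖ < w := by
      intro w hw
      have h := Filter.not_frequently.1 fun hf => hnot ⟨w, hw, hf⟩
      filter_upwards [h] with n hn x s hxs
      by_contra h'
      exact hn ⟨x, s, hxs, not_lt.1 h'⟩
    obtain ⟨V, hVfin, hV⟩ :=
      tautLoopLlc_quantised hv1 hγ hR (fun n => (hlenγ n).le) hd₀ hflat
    obtain ⟨n₀, hn₀⟩ := eventually_atTop.1 hV
    set W : Set ℝ := {x ∈ V | |x| < g} with hW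
    have hWfin : W.Finite := hVfin.subset (sep_subset _ _)
    have hWne : hWfin.toFinset.Nonempty :=
      ⟨_, hWfin.mem_toFinset.2 ⟨hn₀ n₀ le_rfl, habs n₀⟩⟩
    obtain ⟨m, hmW, hmax⟩ := hWfin.toFinset.exists_max_image (fun x => |x|) hWne
    have hm : |m| < g := (hWfin.mem_toFinset.1 hmW).2
    obtain ⟨N, hN⟩ := exists_nat_gt (g / (g - |m|))
    set n : ℕ := max n₀ N with hn
    have hin : circulation v (γ n) ∈ hWfin.toFinset :=
      hWfin.mem_toFinset.2 ⟨hn₀ n (le_max_left _ _), habs n⟩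
    have h1 : |circulation v (γ n)| ≤ |m| := hmax _ hin
    have h2 : g / (n + 2) < g - |m| := by
      have hNn : (N:ℝ) ≤ n := by exact_mod_cast le_max_right n₀ N
      rw [div_lt_iff₀ (by linarith)] at hN
      rw [div_lt_iff₀ (by positivity)]
      nlinarith
    linarith [hgγ n]

end Summit.NavierStokesRegularity.NavierStokesRegularity.Theorems

end
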